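import Literature.NumberTheory.DiophantineGeometry.TateAlgorithmInvarianceProofs
import HarnessLib

/-!
# Step 11 of Tate's algorithm read forwards, and AEC VII.1.3 (b) with `v(u) ≤ 1`

Topic `NumberTheory/DiophantineGeometry` (companion proof file of
`Literature.NumberTheory.DiophantineGeometry.TateAlgorithm` / `LocalReduction`; theorems only).
Part of the discharge of the named fact
`Literature.NumberTheory.DiophantineGeometry.kodairaSymbolAt_baseChange_of_ramificationIdx_eq_one`
(Tate's algorithm under unramified base change): the two ingredients of minimality persistence
(`MinimalModelUnramifiedProofs`) that do not involve the second ring.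

* §1 `WeierstrassCurve.valuation_r_le_one_of_isIntegral_of_le`, `…_s_…`, `…_t_…`: Silverman's
  *AEC* VII.1.3 (b) integrality argument for `r, s, t` of a change of variables `D` between two
  `R`-integral equations `W₂ = D • W₁`, under `v(u) ≤ 1` instead of `v(u) = 1` (the printed
  proof — `r` is a root of the monic quartic `r⁴ = b₄ r² + (3 b₆ + A) r − B`, then `s`, `t` roots
  of monic quadratics — uses only `v(u) ≤ 1`; the tree's `valuation_r/s/t_le_one_of_isIntegral`
  (`MinimalModelUniquenessProofs`) are the case `v(u) = 1`).
* §2 `WeierstrassCurve.kodairaSymbolOfMinimal_eq_I_zero_of_pow_dvd` (**Step 11 read forwards**,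
  Silverman ATAEC IV.9.4 Step 11, PDF pp. 346, 354–355): if some `R`-integral change of
  variables brings `N` into the shape `π ∣ a₁, π² ∣ a₂, π³ ∣ a₃, π⁴ ∣ a₄, π⁶ ∣ a₆`, then the
  literal algorithm `WeierstrassCurve.kodairaSymbolOfMinimal` returns the junk `I₀` of its final
  branch on `N`, whatever normalising translations it chooses: by `kodairaSymbolOfMinimal_smul` we
  may run it on `V = D • N`, which is itself normalised for every step, so the rigidity lemmas
  (`dvd_r_t_of_step2`, `dvd_r_s_t_of_step6/8/9`) control the chosen translations and the
  test-invariance lemmas (`dvd_b₂_smul_iff`, …, `pow_six_dvd_a₆_smul_iff`) reduce every test to a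
  divisibility of `V`; the step-6 cubic and step-8 quadratic of `V` are `T³` and `Y²`.

## Prior formalisation in the tree (x11b3-p4 lineage, `Summits/BirchSwinnertonDyer/Rank1Residual/X11b/Three/`)

`KodairaTransportMain.kodairaSymbolOfMinimal_map_of_unif` proves the same DVR-level coupling as
`WeierstrassCurve.kodairaSymbolOfMinimal_map_of_map_uniformizer` (with `[IsLocalHom ψ]` assumed
rather than derived from `hw`); `KodairaTransportFraction.kodairaSymbol_map_of_unif` is the
fraction-field statement WITH a minimality hypothesis `hmin`; `UnramifiedMinimalDescent
.isMinimal_baseChange_of_frobenius` proves minimality persistence on a finite Galois unramified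
layer of local fields by Galois descent of the non-minimality witness (no Tate's algorithm).  The
present Literature-side files exist because a Literature `_holds` cannot import `Summits/…`, and add:
minimality persistence for EVERY ring homomorphism of DVRs with `f π₁ = w π₂` and perfect residue
fields (via Step 11 read forwards), the fraction-field statement without `hmin`, and the discharge
of the registry fact itself at arbitrary Dedekind `A ⊆ B`.

## References

* J. H. Silverman, *The Arithmetic of Elliptic Curves*, GTM 106, 2nd ed. 2009, Prop. VII.1.3 (b)
  (PDF pp. 165–166).
* J. H. Silverman, *Advanced Topics in the Arithmetic of Elliptic Curves*, GTM 151, 1994, IV.9.4,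
  Steps 1–11 (PDF pp. 344–346) and the proof of Step 11 / Cor. 9.1 (PDF pp. 354–355).
-/

open Polynomial IsDedekindDomain

namespace WeierstrassCurve

open Literature.NumberTheory.DiophantineGeometry
  Literature.NumberTheory.DiophantineGeometry.TateAlgorithm

/-! ### §1 Silverman AEC VII.1.3 (b) with `v(u) ≤ 1` -/

section Integrality

variable (R : Type*) [CommRing R] [IsDomain R] [IsDiscreteValuationRing R]
  {K : Type*} [Field K] [Algebra R K] [IsFractionRing R K]

open IsDiscreteValuationRing IsDedekindDomain.HeightOneSpectrum

variable {W₁ W₂ : WeierstrassCurve K} {D : VariableChange K}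

/-- **Silverman, AEC VII.1.3 (b), `r ∈ R`, under `v(u) ≤ 1`.** If `W₁` and `W₂ = D • W₁` both have
coefficients in `R` and `v(u) ≤ 1`, then `v(r) ≤ 1`: the monic quartic
`r⁴ = b₄ r² + (3 b₆ + A) r − B` (`A = u⁶ b₆' − b₆`, `B = u⁸ b₈' − b₈`) has `R`-integral
coefficients. [cite: SilvermanAEC2009, VII.1 Prop. 1.3(b) (PDF p. 165)] -/
theorem valuation_r_le_one_of_isIntegral_of_le [IsIntegral R W₁] [IsIntegral R W₂]
    (h : W₂ = D • W₁) (hu : valuation K (IsDiscreteValuationRing.maximalIdeal R) (D.u : K) ≤ 1) :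
    valuation K (IsDiscreteValuationRing.maximalIdeal R) D.r ≤ 1 := by
  have i₁b₄ : valuation K (IsDiscreteValuationRing.maximalIdeal R) W₁.b₄ ≤ 1 := by
    rw [← integralModel_b₄_eq R W₁]; exact valuation_le_one _ _
  have i₁b₆ : valuation K (IsDiscreteValuationRing.maximalIdeal R) W₁.b₆ ≤ 1 := by
    rw [← integralModel_b₆_eq R W₁]; exact valuation_le_one _ _
  have i₁b₈ : valuation K (IsDiscreteValuationRing.maximalIdeal R) W₁.b₈ ≤ 1 := by
    rw [← integralModel_b₈_eq R W₁]; exact valuation_le_one _ _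
  have i₂b₆ : valuation K (IsDiscreteValuationRing.maximalIdeal R) W₂.b₆ ≤ 1 := by
    rw [← integralModel_b₆_eq R W₂]; exact valuation_le_one _ _
  have i₂b₈ : valuation K (IsDiscreteValuationRing.maximalIdeal R) W₂.b₈ ≤ 1 := by
    rw [← integralModel_b₈_eq R W₂]; exact valuation_le_one _ _
  have hu6 : valuation K (IsDiscreteValuationRing.maximalIdeal R) ((D.u : K) ^ 6) ≤ 1 := by
    rw [map_pow]; exact pow_le_one' hu 6
  have hu8 : valuation K (IsDiscreteValuationRing.maximalIdeal R) ((D.u : K) ^ 8) ≤ 1 := by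
    rw [map_pow]; exact pow_le_one' hu 8
  have hA : valuation K (IsDiscreteValuationRing.maximalIdeal R) ((D.u : K) ^ 6 * W₂.b₆ - W₁.b₆) ≤ 1 := by
    refine Valuation.map_sub_le _ ?_ i₁b₆
    rw [map_mul]; exact mul_le_one' hu6 i₂b₆
  have hB : valuation K (IsDiscreteValuationRing.maximalIdeal R) ((D.u : K) ^ 8 * W₂.b₈ - W₁.b₈) ≤ 1 := by
    refine Valuation.map_sub_le _ ?_ i₁b₈
    rw [map_mul]; exact mul_le_one' hu8 i₂b₈
  have e₆ : (D.u : K) ^ 6 * W₂.b₆ - W₁.b₆ = 2 * D.r * W₁.b₄ + D.r ^ 2 * W₁.b₂ + 4 * D.r ^ 3 := by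
    rw [h, variableChange_b₆]
    linear_combination (W₁.b₆ + 2 * D.r * W₁.b₄ + D.r ^ 2 * W₁.b₂ + 4 * D.r ^ 3) *
      pow_mul_pow_eq_one 6 D.u.mul_inv
  have e₈ : (D.u : K) ^ 8 * W₂.b₈ - W₁.b₈ =
      3 * D.r * W₁.b₆ + 3 * D.r ^ 2 * W₁.b₄ + D.r ^ 3 * W₁.b₂ + 3 * D.r ^ 4 := by
    rw [h, variableChange_b₈]
    linear_combination (W₁.b₈ + 3 * D.r * W₁.b₆ + 3 * D.r ^ 2 * W₁.b₄ + D.r ^ 3 * W₁.b₂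
      + 3 * D.r ^ 4) * pow_mul_pow_eq_one 8 D.u.mul_inv
  refine Literature.NumberTheory.DiophantineGeometry.valuation_le_one_of_pow_four_eq
    (valuation K (IsDiscreteValuationRing.maximalIdeal R)) (x := D.r)
    (p := W₁.b₄) (q := 3 * W₁.b₆ + ((D.u : K) ^ 6 * W₂.b₆ - W₁.b₆))
    (c := -((D.u : K) ^ 8 * W₂.b₈ - W₁.b₈)) i₁b₄ ?_ ?_ ?_
  · refine Valuation.map_add_le _ ?_ hA
    rw [map_mul]
    exact mul_le_one' (by simpa only [map_ofNat] using valuation_le_one (IsDiscreteValuationRing.maximalIdeal R) (3 : R))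
      i₁b₆
  · rw [Valuation.map_neg]; exact hB
  · linear_combination e₈ - D.r * e₆

/-- **Silverman, AEC VII.1.3 (b), `s ∈ R`** (given `r ∈ R`, under `v(u) ≤ 1`): the monic quadratic
`s² = −a₁ s + (a₂ + 3r − u² a₂')` has `R`-integral coefficients.
[cite: SilvermanAEC2009, VII.1 Prop. 1.3(b) (PDF p. 165)] -/
theorem valuation_s_le_one_of_isIntegral_of_le [IsIntegral R W₁] [IsIntegral R W₂]
    (h : W₂ = D • W₁) (hu : valuation K (IsDiscreteValuationRing.maximalIdeal R) (D.u : K) ≤ 1)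
    (hr : valuation K (IsDiscreteValuationRing.maximalIdeal R) D.r ≤ 1) :
    valuation K (IsDiscreteValuationRing.maximalIdeal R) D.s ≤ 1 := by
  have i₁a₁ : valuation K (IsDiscreteValuationRing.maximalIdeal R) W₁.a₁ ≤ 1 := by
    rw [← integralModel_a₁_eq R W₁]; exact valuation_le_one _ _
  have i₁a₂ : valuation K (IsDiscreteValuationRing.maximalIdeal R) W₁.a₂ ≤ 1 := by
    rw [← integralModel_a₂_eq R W₁]; exact valuation_le_one _ _
  have i₂a₂ : valuation K (IsDiscreteValuationRing.maximalIdeal R) W₂.a₂ ≤ 1 := by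
    rw [← integralModel_a₂_eq R W₂]; exact valuation_le_one _ _
  have e₂ : D.s ^ 2 = (-W₁.a₁) * D.s + (W₁.a₂ + 3 * D.r - (D.u : K) ^ 2 * W₂.a₂) := by
    rw [h, variableChange_a₂]
    linear_combination (W₁.a₂ - D.s * W₁.a₁ + 3 * D.r - D.s ^ 2) *
      pow_mul_pow_eq_one 2 D.u.mul_inv
  refine Literature.NumberTheory.DiophantineGeometry.valuation_le_one_of_sq_eq
    (valuation K (IsDiscreteValuationRing.maximalIdeal R)) (by rwa [Valuation.map_neg]) ?_ e₂
  refine Valuation.map_sub_le _ (Valuation.map_add_le _ i₁a₂ ?_) ?_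
  · rw [map_mul]
    exact mul_le_one' (by simpa only [map_ofNat] using valuation_le_one (IsDiscreteValuationRing.maximalIdeal R) (3 : R)) hr
  · rw [map_mul, map_pow]; exact mul_le_one' (pow_le_one' hu 2) i₂a₂

/-- **Silverman, AEC VII.1.3 (b), `t ∈ R`** (given `r ∈ R`, under `v(u) ≤ 1`): the monic quadratic
`t² = −(a₃ + r a₁) t + (a₆ + r a₄ + r² a₂ + r³ − u⁶ a₆')` has `R`-integral coefficients.
[cite: SilvermanAEC2009, VII.1 Prop. 1.3(b) (PDF p. 165)] -/
theorem valuation_t_le_one_of_isIntegral_of_le [IsIntegral R W₁] [IsIntegral R W₂]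
    (h : W₂ = D • W₁) (hu : valuation K (IsDiscreteValuationRing.maximalIdeal R) (D.u : K) ≤ 1)
    (hr : valuation K (IsDiscreteValuationRing.maximalIdeal R) D.r ≤ 1) :
    valuation K (IsDiscreteValuationRing.maximalIdeal R) D.t ≤ 1 := by
  have i₁a₁ : valuation K (IsDiscreteValuationRing.maximalIdeal R) W₁.a₁ ≤ 1 := by
    rw [← integralModel_a₁_eq R W₁]; exact valuation_le_one _ _
  have i₁a₂ : valuation K (IsDiscreteValuationRing.maximalIdeal R) W₁.a₂ ≤ 1 := by
    rw [← integralModel_a₂_eq R W₁]; exact valuation_le_one _ _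
  have i₁a₃ : valuation K (IsDiscreteValuationRing.maximalIdeal R) W₁.a₃ ≤ 1 := by
    rw [← integralModel_a₃_eq R W₁]; exact valuation_le_one _ _
  have i₁a₄ : valuation K (IsDiscreteValuationRing.maximalIdeal R) W₁.a₄ ≤ 1 := by
    rw [← integralModel_a₄_eq R W₁]; exact valuation_le_one _ _
  have i₁a₆ : valuation K (IsDiscreteValuationRing.maximalIdeal R) W₁.a₆ ≤ 1 := by
    rw [← integralModel_a₆_eq R W₁]; exact valuation_le_one _ _
  have i₂a₆ : valuation K (IsDiscreteValuationRing.maximalIdeal R) W₂.a₆ ≤ 1 := by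
    rw [← integralModel_a₆_eq R W₂]; exact valuation_le_one _ _
  have e₆ : D.t ^ 2 = (-(W₁.a₃ + D.r * W₁.a₁)) * D.t +
      (W₁.a₆ + D.r * W₁.a₄ + D.r ^ 2 * W₁.a₂ + D.r ^ 3 - (D.u : K) ^ 6 * W₂.a₆) := by
    rw [h, variableChange_a₆]
    linear_combination (W₁.a₆ + D.r * W₁.a₄ + D.r ^ 2 * W₁.a₂ + D.r ^ 3 - D.t * W₁.a₃
      - D.t ^ 2 - D.r * D.t * W₁.a₁) * pow_mul_pow_eq_one 6 D.u.mul_inv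
  have hr2 : valuation K (IsDiscreteValuationRing.maximalIdeal R) (D.r ^ 2) ≤ 1 := by
    rw [map_pow]; exact pow_le_one' hr 2
  have hr3 : valuation K (IsDiscreteValuationRing.maximalIdeal R) (D.r ^ 3) ≤ 1 := by
    rw [map_pow]; exact pow_le_one' hr 3
  refine Literature.NumberTheory.DiophantineGeometry.valuation_le_one_of_sq_eq
    (valuation K (IsDiscreteValuationRing.maximalIdeal R)) ?_ ?_ e₆
  · rw [Valuation.map_neg]
    refine Valuation.map_add_le _ i₁a₃ ?_
    rw [map_mul]; exact mul_le_one' hr i₁a₁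
  · refine Valuation.map_sub_le _ ?_ ?_
    · refine Valuation.map_add_le _ (Valuation.map_add_le _ (Valuation.map_add_le _ i₁a₆ ?_) ?_) hr3
      · rw [map_mul]; exact mul_le_one' hr i₁a₄
      · rw [map_mul]; exact mul_le_one' hr2 i₁a₂
    · rw [map_mul, map_pow]; exact mul_le_one' (pow_le_one' hu 6) i₂a₆

end Integrality

/-! ### §2 Step 11 read forwards -/

section LemmaJ

open IsLocalRing

variable {R : Type*} [CommRing R] [IsDomain R] [IsDiscreteValuationRing R]

/-- **Step 11 read forwards** (Silverman ATAEC IV.9.4, Steps 1–11): if some `R`-integral change of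
variables `D` (with `u ∈ Rˣ`) brings a Weierstrass equation `N` over the DVR `R` (perfect residue
field) into the shape `π ∣ a₁, π² ∣ a₂, π³ ∣ a₃, π⁴ ∣ a₄, π⁶ ∣ a₆`, then every test of steps
1–10 of the literal algorithm `WeierstrassCurve.kodairaSymbolOfMinimal` fails on `N` — whatever
normalising translations it chooses — and the junk value `I₀` of the final branch (Step 11: "the
equation was not minimal") is returned.  Proof: by the tree's `kodairaSymbolOfMinimal_smul`
(`TateAlgorithmInvarianceProofs` — stated and proved for EVERY Weierstrass equation over `R` and every
change of variables over `R`, with NO minimality and NO `Δ ≠ 0` hypothesis) we may run the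
algorithm on `V = D • N`; `V` itself is normalised for every step, so the rigidity lemmas
(`dvd_r_t_of_step2`, `dvd_r_s_t_of_step6/8/9`) control the chosen translations and the
test-invariance lemmas (`dvd_b₂_smul_iff`, …, `pow_six_dvd_a₆_smul_iff`) reduce every test to
the corresponding divisibility of `V`, which holds; the step-6 cubic and the step-8 quadratic of
`V` are `T³` and `Y²`. [cite: SilvermanATAEC1994, IV.9.4 Step 11 (PDF pp. 346, 354–355)] -/
theorem kodairaSymbolOfMinimal_eq_I_zero_of_pow_dvd [PerfectField (ResidueField R)]
    (N : WeierstrassCurve R) (D : VariableChange R)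
    (h1 : uniformizer R ∣ (D • N).a₁) (h2 : uniformizer R ^ 2 ∣ (D • N).a₂)
    (h3 : uniformizer R ^ 3 ∣ (D • N).a₃) (h4 : uniformizer R ^ 4 ∣ (D • N).a₄)
    (h6 : uniformizer R ^ 6 ∣ (D • N).a₆) :
    N.kodairaSymbolOfMinimal = .I 0 := by
  classical
  rw [← kodairaSymbolOfMinimal_smul N D]
  set V := D • N with hV
  clear_value V
  set ϖ := uniformizer R with hϖdef
  -- divisibilities of `V`
  have h1' : ϖ ^ 1 ∣ V.a₁ := by rwa [pow_one]
  have d2 : ϖ ∣ V.a₂ := (dvd_pow_self ϖ two_ne_zero).trans h2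
  have d3₁ : ϖ ∣ V.a₃ := (dvd_pow_self ϖ three_ne_zero).trans h3
  have d3₂ : ϖ ^ 2 ∣ V.a₃ := (pow_dvd_pow ϖ (by norm_num)).trans h3
  have d4₁ : ϖ ∣ V.a₄ := (dvd_pow_self ϖ four_ne_zero).trans h4
  have d4₂ : ϖ ^ 2 ∣ V.a₄ := (pow_dvd_pow ϖ (by norm_num)).trans h4
  have d4₃ : ϖ ^ 3 ∣ V.a₄ := (pow_dvd_pow ϖ (by norm_num)).trans h4
  have d6₁ : ϖ ∣ V.a₆ := (dvd_pow_self ϖ (by norm_num)).trans h6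
  have d6₂ : ϖ ^ 2 ∣ V.a₆ := (pow_dvd_pow ϖ (by norm_num)).trans h6
  have d6₃ : ϖ ^ 3 ∣ V.a₆ := (pow_dvd_pow ϖ (by norm_num)).trans h6
  have d6₄ : ϖ ^ 4 ∣ V.a₆ := (pow_dvd_pow ϖ (by norm_num)).trans h6
  have d6₅ : ϖ ^ 5 ∣ V.a₆ := (pow_dvd_pow ϖ (by norm_num)).trans h6
  have hb₂ : ϖ ∣ V.b₂ := by
    simpa using pow_dvd_b₂_of_pow_dvd_a ϖ V (n := 1) h1' h2 (by norm_num) (by norm_num)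
  have hb₆ : ϖ ^ 3 ∣ V.b₆ := pow_dvd_b₆_of_pow_dvd_a ϖ V (n := 3) h3 h6 (by norm_num) (by norm_num)
  have hb₈ : ϖ ^ 3 ∣ V.b₈ :=
    pow_dvd_b₈_of_pow_dvd_a ϖ V (n := 3) h1' h2 h3 h4 h6 (by norm_num) (by norm_num) (by norm_num)
      (by norm_num) (by norm_num)
  have hΔ : ϖ ∣ V.Δ := by
    simpa using pow_dvd_Δ_of_pow_dvd_a ϖ V 1 h1' h2 h3 h4 h6 1 1 1 1 (by norm_num) (by norm_num)
      (by norm_num) (by norm_num) (by norm_num) (by norm_num) (by norm_num) (by norm_num)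
      (by norm_num) (by norm_num) (by norm_num) (by norm_num) (by norm_num) (by norm_num)
      (by norm_num)
  have hΔm : V.Δ ∈ maximalIdeal R := mem_maximalIdeal_iff_dvd.mpr hΔ
  unfold kodairaSymbolOfMinimal
  simp only []
  -- Step 1
  rw [if_neg (not_not_intro hΔm)]
  -- Step 2 normalisation
  have hex2 := exists_variableChange_step2_of_perfectField V hΔm
  have e2 : normalizeStep2 V = hex2.choose • V := by
    unfold normalizeStep2; rw [dif_pos hex2]
  rw [e2]
  obtain ⟨hu2, p3, p4, p6⟩ := hex2.choose_spec
  have n3 := mem_maximalIdeal_iff_dvd.mp p3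
  have n4 := mem_maximalIdeal_iff_dvd.mp p4
  have n6 := mem_maximalIdeal_iff_dvd.mp p6
  obtain ⟨hr₂, ht₂⟩ := dvd_r_t_of_step2 hu2 d3₁ d4₁ d6₁ n3 n4 n6
  -- Steps 2–5 tests
  have hb₂' : ϖ ∣ (hex2.choose • V).b₂ := (dvd_b₂_smul_iff hu2 hr₂).mpr hb₂
  rw [if_neg (not_not_intro (mem_maximalIdeal_iff_dvd.mpr hb₂'))]
  have ha₆' : ϖ ^ 2 ∣ (hex2.choose • V).a₆ := (sq_dvd_a₆_smul_iff hu2 d3₁ d4₁ hr₂ ht₂).mpr d6₂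
  rw [if_neg (not_not_intro (mem_maximalIdeal_pow_iff_dvd.mpr ha₆'))]
  have hb₈' : ϖ ^ 3 ∣ (hex2.choose • V).b₈ := (cube_dvd_b₈_smul_iff hu2 d3₁ d4₁ d6₂ hr₂).mpr hb₈
  rw [if_neg (not_not_intro (mem_maximalIdeal_pow_iff_dvd.mpr hb₈'))]
  have hb₆' : ϖ ^ 3 ∣ (hex2.choose • V).b₆ :=
    (cube_dvd_b₆_smul_iff hu2 d3₁ d6₂ hb₂ hb₈ hr₂).mpr hb₆
  rw [if_neg (not_not_intro (mem_maximalIdeal_pow_iff_dvd.mpr hb₆'))]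
  -- Step 6 normalisation
  have hex6 := exists_variableChange_step6_of_dvd n3 n4 ha₆' hb₂' hb₆' hb₈'
  have e6 : normalizeStep6 (hex2.choose • V) = hex6.choose • (hex2.choose • V) := by
    unfold normalizeStep6; rw [dif_pos hex6]
  rw [e6]
  obtain ⟨hu6, s1, s2, s3, s4, s6⟩ := hex6.choose_spec
  have hE₆ : hex6.choose • (hex2.choose • V) = (hex6.choose * hex2.choose) • V := by rw [mul_smul]
  rw [hE₆] at s1 s2 s3 s4 s6 ⊢
  set E₆ := hex6.choose * hex2.choose with hE₆def
  have huE₆ : E₆.u = 1 := by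
    rw [hE₆def]; change hex6.choose.u * hex2.choose.u = 1; rw [hu6, hu2, one_mul]
  clear_value E₆
  have q1 := mem_maximalIdeal_iff_dvd.mp s1
  have q2 := mem_maximalIdeal_iff_dvd.mp s2
  have q3 := mem_maximalIdeal_pow_iff_dvd.mp s3
  have q4 := mem_maximalIdeal_pow_iff_dvd.mp s4
  have q6 := mem_maximalIdeal_pow_iff_dvd.mp s6
  obtain ⟨hr₆, hs₆, ht₆⟩ := dvd_r_s_t_of_step6 huE₆ h1 d2 d3₂ d4₂ d6₃ q1 q2 q3 q4 q6
  -- Steps 6–7 tests: the cubic of `V` is `T³`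
  have c6 : distinctRootCount (cubicStep6 (E₆ • V)) = 1 := by
    rw [distinctRootCount_cubicStep6_smul huE₆ h1 d2 d3₂ d4₂ d6₃ hr₆ hs₆ ht₆]
    have hP : cubicStep6 V = X ^ 3 := by
      rw [cubicStep6, redCoeff_eq_zero_of_dvd h2, redCoeff_eq_zero_of_dvd d4₃,
        redCoeff_eq_zero_of_dvd d6₄, map_zero, zero_mul, zero_mul, add_zero, add_zero, add_zero]
    rw [hP]; exact distinctRootCount_X_pow_three
  have h6ne : distinctRootCount (cubicStep6 (E₆ • V)) ≠ 3 := by rw [c6]; decide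
  have h7ne : distinctRootCount (cubicStep6 (E₆ • V)) ≠ 2 := by rw [c6]; decide
  rw [if_neg h6ne, if_neg h7ne]
  -- Step 8 normalisation
  have hex8 := exists_variableChange_step8_of_dvd q1 q2 q3 q4 q6 h6ne h7ne
  have e8 : normalizeStep8 (E₆ • V) = hex8.choose • (E₆ • V) := by
    unfold normalizeStep8; rw [dif_pos hex8]
  rw [e8]
  obtain ⟨hu8, t1, t2, t3, t4, t6⟩ := hex8.choose_spec
  have hE₈ : hex8.choose • (E₆ • V) = (hex8.choose * E₆) • V := by rw [mul_smul]
  rw [hE₈] at t1 t2 t3 t4 t6 ⊢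
  set E₈ := hex8.choose * E₆ with hE₈def
  have huE₈ : E₈.u = 1 := by
    rw [hE₈def]; change hex8.choose.u * E₆.u = 1; rw [hu8, huE₆, one_mul]
  clear_value E₈
  have y1 := mem_maximalIdeal_iff_dvd.mp t1
  have y2 := mem_maximalIdeal_pow_iff_dvd.mp t2
  have y3 := mem_maximalIdeal_pow_iff_dvd.mp t3
  have y4 := mem_maximalIdeal_pow_iff_dvd.mp t4
  have y6 := mem_maximalIdeal_pow_iff_dvd.mp t6
  obtain ⟨hr₈, hs₈, ht₈⟩ := dvd_r_s_t_of_step8 huE₈ h1 h2 d3₂ d4₃ d6₄ y1 y2 y3 y4 y6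
  -- Step 8 test: the quadratic of `V` is `Y²`
  have q8 : distinctRootCount (quadraticStep8 (E₈ • V)) ≠ 2 := by
    rw [Ne, distinctRootCount_quadraticStep8_smul huE₈ h1 d2 d3₂ d4₃ d6₄ hr₈ hs₈ ht₈, quadraticStep8,
      redCoeff_eq_zero_of_dvd h3, redCoeff_eq_zero_of_dvd d6₅, distinctRootCount_sq_add_sub_eq_two_iff]
    simp
  rw [if_neg q8]
  -- Step 9 normalisation
  have hex9 := exists_variableChange_step9_of_dvd y1 y2 y3 y4 y6 q8
  have e9 : normalizeStep9 (E₈ • V) = hex9.choose • (E₈ • V) := by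
    unfold normalizeStep9; rw [dif_pos hex9]
  rw [e9]
  obtain ⟨hu9, o1, o2, o3, o4, o6⟩ := hex9.choose_spec
  have hE₉ : hex9.choose • (E₈ • V) = (hex9.choose * E₈) • V := by rw [mul_smul]
  rw [hE₉] at o1 o2 o3 o4 o6 ⊢
  set E₉ := hex9.choose * E₈ with hE₉def
  have huE₉ : E₉.u = 1 := by
    rw [hE₉def]; change hex9.choose.u * E₈.u = 1; rw [hu9, huE₈, one_mul]
  clear_value E₉
  have g1 := mem_maximalIdeal_iff_dvd.mp o1
  have g2 := mem_maximalIdeal_pow_iff_dvd.mp o2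
  have g3 := mem_maximalIdeal_pow_iff_dvd.mp o3
  have g4 := mem_maximalIdeal_pow_iff_dvd.mp o4
  have g6 := mem_maximalIdeal_pow_iff_dvd.mp o6
  obtain ⟨hr₉, hs₉, ht₉⟩ := dvd_r_s_t_of_step9 huE₉ h1 h2 h3 d4₃ d6₅ g1 g2 g3 g4 g6
  -- Steps 9–10 tests
  have a4' : ϖ ^ 4 ∣ (E₉ • V).a₄ := (pow_four_dvd_a₄_smul_iff huE₉ h1 h2 h3 hr₉ hs₉ ht₉).mpr h4
  rw [if_neg (not_not_intro (mem_maximalIdeal_pow_iff_dvd.mpr a4'))]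
  have a6' : ϖ ^ 6 ∣ (E₉ • V).a₆ := (pow_six_dvd_a₆_smul_iff huE₉ h1 h2 h3 h4 hr₉ ht₉).mpr h6
  rw [if_neg (not_not_intro (mem_maximalIdeal_pow_iff_dvd.mpr a6'))]

end LemmaJ

end WeierstrassCurve
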